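import Literature.Computability.QuantumComplexity.RevCleanPoly
import HarnessLib

/-!
# The number of operations of the reversible tableau and of the garbage-free block

Trunk `CryptoQuantFine`; bookkeeping sequel of `RevCleanPoly.lean`. The reversible tableau
`RevSim.comp e M n` of `RevTableau.lean` and the clean block `RevClean.cleanOps e M n₀ v` of
`RevUncompute.lean` are explicit concatenations of `flatMap`s over ranges of polynomial length of
gadgets of constant length; this file records the resulting bound on their NUMBER OF OPERATIONS as the
value of an explicit polynomial (`RevClean.cleanLenPoly`, **`RevClean.length_cleanOps_le`**) —
Arora–Barak 2009, Remark 6.7 ("the circuit … is not only of polynomial size but …"). It is the size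
half of what the uniformity files (`RevTableauUniform.lean`, `RevUncomputeUniform.lean`) establish
implicitly, needed when such a block is stored as non-uniform advice
(`StabilizerRankPermanent.lean`, discharge of Mehraban–Tahmasbi 2024, Thm. 1.6).

## References

* S. Arora, B. Barak, *Computational Complexity: A Modern Approach*, CUP 2009, §6.1, Remark 6.7;
  Thm. 6.6 (polynomial-size circuits of a polynomial-time machine).
-/

noncomputable section

namespace Literature.Computability.QuantumComplexity

open Polynomial Complexity Complexity.FinTM2Sim Turing

/-! ### Generic `flatMap` length bounds -/

/-- A `flatMap` of lists of length `≤ c` has length `≤ c · |l|`. [folklore] -/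
theorem length_flatMap_le_of_le {α β : Type*} (l : List α) (f : α → List β) (c : ℕ) (h : ∀ a ∈ l, (f a).length ≤ c) :
    (l.flatMap f).length ≤ c * l.length := by
  induction l with
  | nil => simp
  | cons a l ih =>
    rw [List.flatMap_cons, List.length_append, List.length_cons]
    have := h a List.mem_cons_self
    have := ih fun a' ha' => h a' (List.mem_cons_of_mem _ ha')
    nlinarith

namespace RevSim

variable (tm : FinTM2) (e : ℕ)

/-- `|vList| = nV`. [folklore] -/
theorem length_vList : (vList tm).length = nV tm := by simp [vList]

/-- `|kaList| = CW`. [folklore] -/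
theorem length_kaList : (kaList tm).length = CW tm := by simp [kaList]

/-- A chain has at most as many operations as literals. [folklore] -/
theorem length_clChain_le {ι : Type*} [DecidableEq ι] (a₀ : ι) : ∀ (ls as : List ι), (clChain a₀ ls as).length ≤ ls.length
  | [], as => by simp
  | l :: ls, [] => by simp [clChain]
  | l :: ls, a :: as => by
    rw [clChain_cons_cons, List.length_cons, List.length_cons]
    exact Nat.succ_le_succ (length_clChain_le a ls as)

/-- A bound on the number of operations of one step of the tableau. [folklore] -/
def stepLen (n : ℕ) : ℕ := rr tm * nV tm + (nV tm + (CW tm * nV tm * Sn tm e n + nK tm * dd tm))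

/-- **One step has at most `stepLen` operations.** [cite: AroraBarak2009, Remark 6.7] -/
theorem length_stepOps_le (n t : ℕ) : (stepOps tm e n t).length ≤ stepLen tm e n := by
  unfold stepOps restOps stepLen
  rw [List.length_append, List.length_append, List.length_append]
  have h1 : ((vList tm).flatMap (chainOps tm e n t)).length ≤ rr tm * (vList tm).length :=
    length_flatMap_le_of_le _ _ _ fun v _ => by
      unfold chainOps
      exact (length_clChain_le _ _ _).trans (by rw [length_lits])
  have h2 : ((vList tm).flatMap (ctrlOps tm e n t)).length ≤ 1 * (vList tm).length :=
    length_flatMap_le_of_le _ _ _ fun v _ => by simp [ctrlOps]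
  have h3 : ((List.range (Sn tm e n)).flatMap (cellOps tm e n t)).length ≤ (CW tm * nV tm) * (List.range (Sn tm e n)).length :=
    length_flatMap_le_of_le _ _ _ fun j _ => by
      unfold cellOps
      refine (length_flatMap_le_of_le _ _ (nV tm) fun ka _ => ?_).trans (by rw [length_kaList, mul_comm])
      refine (length_flatMap_le_of_le _ _ 1 fun v _ => ?_).trans (by rw [length_vList, one_mul])
      unfold cellOp
      split_ifs <;> simp
  have h4 : ((List.range' (Sn tm e n) (dd tm)).flatMap (phantomOps tm e n t)).length ≤ nK tm * (List.range' (Sn tm e n) (dd tm)).length :=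
    length_flatMap_le_of_le _ _ _ fun j _ => by simp [phantomOps, length_kList]
  rw [length_vList] at h1 h2
  rw [List.length_range] at h3
  rw [List.length_range'] at h4
  omega

variable (M : TM2ComputableAux Bool Bool)

/-- A bound on the number of operations of the input layer. [folklore] -/
def inputLen (n : ℕ) : ℕ := 1 + ((3 + nK M.tm) * n + nK M.tm * (Sn M.tm e n + dd M.tm - n))

/-- **The input layer has at most `inputLen` operations.** [cite: AroraBarak2009, Remark 6.7] -/
theorem length_inputOps_le (n : ℕ) : (inputOps e M n).length ≤ inputLen e M n := by
  unfold inputOps inputLen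
  rw [List.length_append, List.length_append, List.length_singleton]
  have h1 : ((List.range n).flatMap (inCell e M n)).length ≤ (3 + nK M.tm) * (List.range n).length :=
    length_flatMap_le_of_le _ _ _ fun i _ => by
      unfold inCell
      rw [List.length_append, List.length_map]
      have := List.length_filter_le (fun k => k ≠ M.tm.k₀) (kList M.tm)
      rw [length_kList] at this
      simp only [List.length_cons, List.length_nil]
      omega
  have h2 : ((List.range' n (Sn M.tm e n + dd M.tm - n)).flatMap (emptyCell M.tm e n)).length ≤
      nK M.tm * (List.range' n (Sn M.tm e n + dd M.tm - n)).length :=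
    length_flatMap_le_of_le _ _ _ fun i _ => by simp [emptyCell, length_kList]
  rw [List.length_range] at h1
  rw [List.length_range'] at h2
  omega

/-- A bound on the number of operations of the tableau. [folklore] -/
def compLen (n : ℕ) : ℕ := inputLen e M n + stepLen M.tm e n * Tn e n

end RevSim

namespace RevClean

open RevSim

variable (e : ℕ) (M : TM2ComputableAux Bool Bool)

/-- **The tableau has at most `compLen` operations.** [cite: AroraBarak2009, Remark 6.7] -/
theorem length_comp_le (n : ℕ) : (comp e M n).length ≤ compLen e M n := by
  unfold comp compLen
  rw [List.length_append]
  have h1 := length_inputOps_le e M n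
  have h2 : ((List.range (Tn e n)).flatMap (stepOps M.tm e n)).length ≤ stepLen M.tm e n * (List.range (Tn e n)).length :=
    length_flatMap_le_of_le _ _ _ fun t _ => length_stepOps_le M.tm e n t
  rw [List.length_range] at h2
  omega

/-- The read-out layer has `JJ · A₁` operations. [folklore] -/
theorem length_outOps (n : ℕ) : (outOps e M n).length = JJ e M n * A₁ M := by
  unfold outOps copyOps outPairs
  rw [List.length_map, List.length_flatMap]
  have : ∀ j ∈ List.range (JJ e M n), ((aList M).map fun a => (cellW M.tm e n (Tn e n) j ⟨M.tm.k₁, a⟩, resW e M n j a)).length = A₁ M :=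
    fun j _ => by simp [aList]
  rw [List.map_congr_left this, List.map_const', List.sum_replicate, List.length_range, smul_eq_mul]

/-- The suffix writer has at most `|v|` operations. [folklore] -/
theorem length_notsV_le (n₀ : ℕ) (v : List Bool) : (notsV n₀ v).length ≤ v.length := by
  unfold notsV
  rw [List.length_map]
  exact (List.length_filter_le _ _).trans (by rw [List.length_range])

/-- A bound on the number of operations of the clean block with tableau length `n` and a suffix of
length `l`. [folklore] -/
def cleanLen (n l : ℕ) : ℕ := 2 * l + (2 * compLen e M n + JJ e M n * A₁ M)

/-- **The clean block has at most `cleanLen` operations.** [cite: AroraBarak2009, Remark 6.7] -/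
theorem length_cleanOps_le (n₀ : ℕ) (v : List Bool) :
    (cleanOps e M n₀ v).length ≤ cleanLen e M (n₀ + v.length) v.length := by
  unfold cleanOps cleanLen
  simp only [List.length_append, List.length_reverse]
  have h1 := length_notsV_le n₀ v
  have h2 := length_comp_le e M (n₀ + v.length)
  have h3 := length_outOps e M (n₀ + v.length)
  omega

/-! ### As polynomials -/

/-- `stepLen` as a polynomial. [folklore] -/
def stepLenPoly : Polynomial ℕ :=
  C (rr M.tm * nV M.tm) + (C (nV M.tm) + (C (CW M.tm * nV M.tm) * SnPoly M.tm e + C (nK M.tm * dd M.tm)))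

/-- Value of `stepLenPoly`. [folklore] -/
@[simp] theorem eval_stepLenPoly (n : ℕ) : (stepLenPoly e M).eval n = stepLen M.tm e n := by
  simp [stepLenPoly, stepLen]

/-- An upper bound for `inputLen` as a polynomial (the `ℕ`-subtraction dropped). [folklore] -/
def inputLenPoly : Polynomial ℕ := 1 + (C (3 + nK M.tm) * X + C (nK M.tm) * (SnPoly M.tm e + C (dd M.tm)))

/-- `inputLen ≤ inputLenPoly`. [folklore] -/
theorem inputLen_le_eval (n : ℕ) : inputLen e M n ≤ (inputLenPoly e M).eval n := by
  simp only [inputLenPoly, inputLen, eval_add, eval_one, eval_mul, eval_C, eval_X, eval_SnPoly]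
  have : Sn M.tm e n + dd M.tm - n ≤ Sn M.tm e n + dd M.tm := Nat.sub_le _ _
  have := Nat.mul_le_mul_left (nK M.tm) this
  omega

/-- An upper bound for `cleanLen e M n l` with `l ≤ n` as a polynomial in `n`. [folklore] -/
def cleanLenPoly : Polynomial ℕ :=
  2 * X + (2 * (inputLenPoly e M + stepLenPoly e M * TnPoly e) + JJPoly e M * C (A₁ M))

/-- **`|cleanOps| ≤ cleanLenPoly (n₀ + |v|)`.** [cite: AroraBarak2009, Remark 6.7] -/
theorem length_cleanOps_le_eval (n₀ : ℕ) (v : List Bool) :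
    (cleanOps e M n₀ v).length ≤ (cleanLenPoly e M).eval (n₀ + v.length) := by
  refine (length_cleanOps_le e M n₀ v).trans ?_
  have hi := inputLen_le_eval e M (n₀ + v.length)
  simp only [cleanLenPoly, cleanLen, compLen, eval_add, eval_mul, eval_ofNat, eval_X, eval_stepLenPoly, eval_TnPoly,
    eval_JJPoly, eval_C]
  have := Nat.mul_le_mul_right (Tn e (n₀ + v.length)) (le_refl (stepLen M.tm e (n₀ + v.length)))
  nlinarith

end RevClean

end Literature.Computability.QuantumComplexity

end
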